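import Literature.MathematicalPhysics.QuantumFieldTheory.Balaban1983to89.B9Thm310GTorusRegular
import Literature.MathematicalPhysics.QuantumFieldTheory.Balaban1983to89.B9Thm39CinvSepMiddle
import Literature.MathematicalPhysics.QuantumFieldTheory.Balaban1983to89.B9Thm39CinvTorusRegular
import Literature.MathematicalPhysics.QuantumFieldTheory.Balaban1983to89.B9Eq395Small

/-!
# `Balaban1983to89.B9Eq3105FamTwoCore` — FAMILY 2 OF (3.105), `(1 − ζ_□̃)·DPD*·h_□O_□h_□`, PER CUBE ON THE MEMBER's BOND CARRIER: [4] (2.83) WITH THE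
# SEPARATION `d(supp(1 − ζ_□̃), supp h_□) ≥ D_sep` IN THE MIDDLE ⟹ `≺ 𝟙[b′ ∈ S_□]·(K_PB_OΛc₁·e^{−a_sep·δ₀·D_sep})·e^{−ρδ₀d(a,b′)}`, for ANY site cut-off `ζ` with
# `|1 − ζ| ≤ 1` and the separation, ANY `P` with a (3.49)₄-shape block majorant and ANY letter `O` with a (3.42)₀-shape block majorant (sub-row G-B9-LETTERS, GAPS
# G-B9-05 «family 2 of (3.105)», programme ZETA-2, FILE Z2-core; lead g34 RULING FAMFOUR SPLIT 2026-08-28)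

statement-level skeleton of published theorems with citation tags; proofs where landed; nothing here is a claim about the Yang–Mills mass gap

THE PRINTED LOCUS (verbatim, held `paper:balaban1985-cmp99-background-propagators`, journal page = PDF page + 388).  p. 414 (3.105): «Δ_aG₀ = I − Σ_□K(h_□)G_□h_□ −
Σ_□(1 − ζ_□̃)DPD*h_□G_□h_□ − … = I − R, … This implies that supp h_□ is separated from supp (1 − ζ_□̃) by a distance ≧ M. … Next we will analyze the other operators
in R and we will prove that they are small also.»; p. 399 (3.49) («DPD* has a regular kernel»); p. 411 l. 12–14 («hence using the estimates (3.42), (3.48) … we get the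
bound with the exponential factor»); p. 412 l. 31–36 («exp(−δ₀M) … sufficiently small»); [4] (2.83)–(2.85) pp. 237–238 (the model: outer variable far from □, inner
factor localized at □, exponential kernels ⟹ `e^{−aD}·e^{−ρd}`), (2.51)–(2.55) p. 232, Lemma 2.1 (2.61) p. 234.

WHY THIS FILE.  The consumer `B9Thm310DeltaAIsUnitOfExpansion.eBlock_kernelFamilyBInv_GAY_of_localInverseCubes''` displays, inside `hrest`, the sum over the
cover cubes of `conj b(((1 − M_{ζ_□}) · DPDsY · (M_{h_□}·O_□(U₁)·M_{h_□})).rS)` with a flat kernel `Θ′e^{−δ₀d}` over the member's bond carrier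
`(toB6 (geo9K i) Rr Hp, fun p => ιB (blkV1 i.hN i.D p.1))`.  THIS FILE is the per-cube estimate: in real coordinates the word is `mulOp(1 − ζ♭)·conj b(P)·mulOp(h♭)·
conj b(O)·mulOp(h♭)` (§1), the rows of `1 − ζ♭` and the support of `h♭` are `D_sep`-separated (displayed as `hζsep`; for the ζ of record `B9Eq3105ZetaY.zetaY` it is
p21's `hsep_cover`, `D_sep = M∕(2L²)`), so r05∕p21's engine `B9Thm39CinvSepMiddle.sepMiddle_majorant_blk` applies with `L := conj b(P) ≺ K_P·ℓ(a)⁻²·e^{−a_Pδ₀d}`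
((3.49)₄, displayed as `hP` — at the member it is r06's letter-free composition engine on the landed member letters, programme ZETA-2's next file), `T := conj b(O) ≺
B_O·ℓ(y)²·e^{−b_Oδ₀d}` ((3.42)₀ of the cube letter over the member, displayed as `hO` — from `hE` by `hasMajorant_conj_G_of_eBlockInvB`), the scale transfer of `ℓ²`
on the member (`B9GeoInputsMultiRateKLevelV1.scaleTransfer_len_sq_geo9K`), (2.61); the trailing `M_{h_□}` then localizes the SOURCE in `S_□ = SQT □` (p21's
`hasMajorant_mul_mulOp_right`), which is what the cover sum needs (`hcnt_SQT`, `hasMajorant_localSum_right`; file Z2-cover).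

WHAT THIS FILE CERTIFIES (kernel-checked; 0 `def`, 0 `def … : Prop`, 0 sorry; standard axioms only)

* §1 `one_sub_mulOp`, `conj_one_sub_cutMulY` (`conj b((1 − M_g).rS) = mulOp(1 − g♭)`), ★ `conj_famTwo_eq` (the word in real coordinates), `mem_SQT_of_hBdY_hTY_ne_zero`
  (`h_□♭(g) ≠ 0 ⇒ ιB(Δ(g₋)) ∈ S_□`), `geo9K_axioms` (the (2.54)∕symmetry∕nonnegativity triple of the member geometry).
* §2 ★★★ `hasMajorant_famTwo_core` — for any `ζ` with `|1 − ζ| ≤ 1` and `hζsep : ζ♭(f) ≠ 1 → h_□♭(g) ≠ 0 → D_sep ≤ d(ιBΔ(f₋), ιBΔ(g₋))`, any `P`, `O` with the displayed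
  majorants, (2.61) at `b_O − ρ`, the scale transfer of `ℓ²` at `α_st`, `α_st + a_sep + ρ ≤ a_P`:
  `conj b(((1 − M_ζ)·P·(M_{h_□}·O·M_{h_□})).rS) ≺ 𝟙[b′ ∈ S_□]·(K_PB_OΛ·c₁(δ₀,b_O−ρ)·e^{−a_sep·δ₀·D_sep})·e^{−ρδ₀·d(a,b′)}` over the member's bond carrier.

HONEST SCOPE ∕ NOT CLAIMED.  DISPLAYED: `hP` (the member-level (3.49)₄ majorant of `conj b(P)` — for `P = DPDsY i parS Gp U₁` it is ZETA-2's next file by r06's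
composition engine; NOT proved here), `hO`, `hζsep`, (2.61), the scale transfer, the numerical side conditions.  NOT here: the cover sum and the datum plug (Z2-cover),
families 3–4, the transposed (`hV′`) word (it carries `P` trailing: α-T's source-global transfer).  `ζ` is arbitrary here (the consumer's binder); the ζ of record is
`B9Eq3105ZetaY.zetaY` (p674649, review lane).  Count-neutral; NOT a node discharge; no summit ∕ sub-problem statement is proved; nothing continuum ∕ OS ∕ mass-gap
∕ Clay; YM mass gap NOT proved (Track A conditional rung).  No `sorry`, no `axiom`, no `… : Prop` fact, no `instance`, no `notation`, no `def`.  NEW file; nothing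
landed is modified.  Cell `lit-balaban`, seat `lit-balaban-p33` gen 102, 2026-08-28; `--supports stmt-QuantumFields-19200` as helper.  Net new unproved facts: 0.

RELATED IN THE TREE, NOT DUPLICATED (searched 2026-08-28: `rg 'famTwo|1 - cutMulY'` estimates = ∅; the consumer only displays the word): r05∕p21
`B9Thm39CinvSepMiddle.sepMiddle_majorant_blk`, p21 `B9Eq395Small.hasMajorant_mul_mulOp_right`, p38 `B9Thm310GTorusRegular` (`hT_of_eBlockInvB_cube` pattern),
r06 `B9Thm39CinvTorusRegular.conj_cutMulY`, p33 D2 `B9Cor36GCubeLocDefectCore` (the same engine on the cube geometry) — all USED BY NAME or as patterns.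
-/

noncomputable section

namespace Literature.MathematicalPhysics.QuantumFieldTheory.Balaban1983to89.B9Eq3105FamTwoCore

open B6RandomWalk (HasMajorant hasMajorant_mono Triangle254 Ineq261 c1_nonneg)
open B9Thm34Ext (toB6)
open B9Thm37Sum (mulOp mulOp_apply)
open B9Ineq347 (ScaleTransfer)
open B9Eq352DivFormLetters (conj)
open B6KLevelCensusIndexV1 (KIdx)
open B6Cover236MultiLevelBlocks (cubes)
open B6GlobalChartV1 (blkV1)
open B6Ineq2142KLevelV1 (β)
open B6Partition118KLevelTorusCentral (blkOf_mem_QT_of_hT_ne_zero)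
open B9GeoNormsKLevelV1 (geo9K)
open B9GeoLemma21KLevelV1 (one_le_Mh geo9K_dist_triangle geo9K_dist_comm geo9K_dist_nonneg')
open B9Thm37CubeCoverCommutators (cutMulY cutMulY_apply hTY hTY_apply)
open B9Thm37CubeCoverCommutatorSizes (side_conditions four_le_P')
open B9Thm37GpTorusRegularCubes (SQT mem_SQT)
open B9Thm39CinvTorusRegular (conj_cutMulY)
open B9Thm39CinvSepMiddle (sepMiddle_majorant_blk)
open B9Eq395Small (hasMajorant_mul_mulOp_right)
open B9Eq3104CutoffCommutators (hBdY hBdY_apply)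
open Node00 (SiteY BlkY IBondY FBondY toKT)
open Node00.OpsYNablaBridge (chartY)

variable {d ℓ : ℕ} {hd : 1 ≤ d + 1} {hL : Odd (ℓ + 1) ∧ 1 < ℓ + 1} {b₀ b₁ : ℝ}
variable {𝔸 : Type} [NormedRing 𝔸] [NormedAlgebra ℂ 𝔸] [CompleteSpace 𝔸]
variable {ι : Type} [Fintype ι]
variable (i : KIdx d ℓ hd hL b₀ b₁) (c : ↥(cubes i.D.toDomains)) (b : Module.Basis ι ℝ 𝔸)

/-! ## §1  The word in real coordinates; the source support; the member geometry's axioms -/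

/-- `1 − mulOp g = mulOp(1 − g)`. [cite: Balaban1984PropagatorsII, (2.79) p.237, bookkeeping] -/
theorem one_sub_mulOp {X : Type} (g : X → ℝ) : (1 : Module.End ℝ (X → ℝ)) - mulOp g = mulOp (fun x => 1 - g x) := by
  refine LinearMap.ext fun μ => funext fun x => ?_
  rw [LinearMap.sub_apply, Pi.sub_apply, mulOp_apply, mulOp_apply, Module.End.one_apply]
  ring

omit [CompleteSpace 𝔸] in
/-- `conj b((1 − M_g).rS) = mulOp(1 − g♭)` (r06's `conj_cutMulY`, `conj_sub`, `conj_one`). [cite: Balaban1984PropagatorsII, (2.52) p.232, bookkeeping] -/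
theorem conj_one_sub_cutMulY (g : FBondY i → ℝ) :
    conj b ((1 - cutMulY (𝔸 := 𝔸) g).restrictScalars ℝ : Module.End ℝ (FBondY i → 𝔸)) = mulOp (fun p : FBondY i × ι => 1 - g p.1) := by
  have h1 : ((1 - cutMulY (𝔸 := 𝔸) g).restrictScalars ℝ : Module.End ℝ (FBondY i → 𝔸)) = 1 - (cutMulY (𝔸 := 𝔸) g).restrictScalars ℝ :=
    LinearMap.ext fun _ => rfl
  rw [h1, B9Eq352DivFormLetters.conj_sub, B9Thm37GpTorusRegular.conj_one, conj_cutMulY, one_sub_mulOp]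

omit [CompleteSpace 𝔸] in
/-- ★ the family-2 word in real coordinates: `conj b(((1 − M_ζ)·P·(M_h·O·M_h)).rS) = (mulOp(1 − ζ♭)·conj b(P.rS)·mulOp(h♭)·conj b(O.rS))·mulOp(h♭)`.
[cite: Balaban1985BackgroundPropagators, (3.105) p.414, (3.87) p.409; Balaban1984PropagatorsII, (2.52)–(2.55) p.232] -/
theorem conj_famTwo_eq (ζ h : SiteY i → ℝ) (P O : (FBondY i → 𝔸) →ₗ[ℂ] (FBondY i → 𝔸)) :
    conj b (((1 - cutMulY (𝔸 := 𝔸) (hBdY i ζ)) * P * (cutMulY (𝔸 := 𝔸) (hBdY i h) * O * cutMulY (𝔸 := 𝔸) (hBdY i h))).restrictScalars ℝ) =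
      (mulOp (fun p : FBondY i × ι => 1 - hBdY i ζ p.1) * conj b (P.restrictScalars ℝ) * mulOp (fun p : FBondY i × ι => hBdY i h p.1) *
        conj b (O.restrictScalars ℝ)) * mulOp (fun p : FBondY i × ι => hBdY i h p.1) := by
  have hsplit : (((1 - cutMulY (𝔸 := 𝔸) (hBdY i ζ)) * P * (cutMulY (𝔸 := 𝔸) (hBdY i h) * O * cutMulY (𝔸 := 𝔸) (hBdY i h))).restrictScalars ℝ :
      Module.End ℝ (FBondY i → 𝔸)) =
      ((1 - cutMulY (𝔸 := 𝔸) (hBdY i ζ)).restrictScalars ℝ) * P.restrictScalars ℝ *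
        ((cutMulY (𝔸 := 𝔸) (hBdY i h)).restrictScalars ℝ * O.restrictScalars ℝ * (cutMulY (𝔸 := 𝔸) (hBdY i h)).restrictScalars ℝ) :=
    LinearMap.ext fun _ => rfl
  rw [hsplit, B9Eq352DivFormLetters.conj_mul, B9Eq352DivFormLetters.conj_mul, B9Eq352DivFormLetters.conj_mul, B9Eq352DivFormLetters.conj_mul,
    conj_one_sub_cutMulY, conj_cutMulY]
  simp only [mul_assoc]

/-- `h_□♭(g) ≠ 0 ⇒ ιB(Δ(g₋)) ∈ S_□` (`supp h_□` meets only blocks of `□⁺`). [cite: Balaban1985BackgroundPropagators, (3.87) p.409, p.408; Balaban1984PropagatorsII, p.235, (2.36) p.229] -/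
theorem mem_SQT_of_hBdY_hTY_ne_zero [Fintype (geo9K i).Site] (ιB : BlkY i → IBondY i) (hι : ∀ s, β i.hN i.D i.hk (ιB s) = s)
    {g : FBondY i} (hg : hBdY i (hTY i c) g ≠ 0) : ιB (blkV1 i.hN i.D g) ∈ SQT i c := by
  obtain ⟨_, hMh2, hR, _⟩ := side_conditions i
  refine (mem_SQT i c _).2 ?_
  rw [hι]
  exact blkOf_mem_QT_of_hT_ne_zero (D := i.D) hMh2 hR (hMh1 := one_le_Mh i) (four_le_P' i) c hg

/-- the member geometry's (2.54), symmetry and nonnegativity. [cite: Balaban1984PropagatorsII, (2.54) p.233, (2.46) p.231, bookkeeping] -/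
theorem geo9K_axioms [Fintype (geo9K i).Site] (Rr : ℝ) (Hp : Prop) :
    Triangle254 (toB6 (geo9K i) Rr Hp) ∧ (∀ a a' : (geo9K i).Site, (geo9K i).dist a a' = (geo9K i).dist a' a) ∧
      (∀ a a' : (geo9K i).Site, 0 ≤ (geo9K i).dist a a') :=
  ⟨(B9Thm34Ext.triangle254_toB6_iff (geo9K i) Rr Hp).2 (geo9K_dist_triangle i), geo9K_dist_comm i, geo9K_dist_nonneg' i⟩

/-! ## §2  The per-cube estimate -/

omit [CompleteSpace 𝔸] in
open Classical in
set_option maxHeartbeats 1600000 in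
/-- ★★★ **FAMILY 2 OF (3.105) PER CUBE ON THE MEMBER's BOND CARRIER.**  Let `ζ` be a site cut-off with `|1 − ζ| ≦ 1` whose defect rows are `D_sep`-separated from
`supp h_□` (`hζsep`), `P` an operator with `conj b(P) ≺ K_P·ℓ(a)⁻²·e^{−a_Pδ₀d}` ((3.49)₄ shape), `O` a letter with `conj b(O) ≺ B_O·ℓ(y)²·e^{−b_Oδ₀d}` ((3.42)₀ shape),
(2.61) at `b_O − ρ`, the scale transfer of `ℓ²` at `α_st`, `α_st + a_sep + ρ ≦ a_P`.  Then
`conj b(((1 − M_ζ)·P·(M_{h_□}·O·M_{h_□})).rS) ≺ 𝟙[b′ ∈ S_□]·(K_PB_OΛc₁(δ₀, b_O − ρ)·e^{−a_sep·δ₀·D_sep})·e^{−ρδ₀d(a,b′)}` — [4] (2.83) with the separated middle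
(`sepMiddle_majorant_blk`), weights `ℓ⁻²·ℓ² = 1`, then the trailing `M_{h_□}` localizes the source in `S_□` (`hasMajorant_mul_mulOp_right`).
[cite: Balaban1985BackgroundPropagators, (3.105) p.414, p.411 l.12–14, p.412 l.31–36, (3.49) p.399, (3.87) p.409; Balaban1984PropagatorsII, (2.83)–(2.85) pp.237–238, (2.52)–(2.55) p.232, Lemma 2.1 (2.61) p.234] -/
theorem hasMajorant_famTwo_core (ζ : SiteY i → ℝ) (hζ1 : ∀ z, |1 - ζ z| ≤ 1)
    [Fintype (geo9K i).Site] (ιB : BlkY i → IBondY i) (hι : ∀ s, β i.hN i.D i.hk (ιB s) = s) (Rr : ℝ) (Hp : Prop) {Dsep : ℝ}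
    (hζsep : ∀ f g : FBondY i, hBdY i ζ f ≠ 1 → hBdY i (hTY i c) g ≠ 0 → Dsep ≤ (geo9K i).dist (ιB (blkV1 i.hN i.D f)) (ιB (blkV1 i.hN i.D g)))
    (P O : (FBondY i → 𝔸) →ₗ[ℂ] (FBondY i → 𝔸)) (dB : ℕ) {δ₀ aP bO αst asep ρ KP BO Λ : ℝ}
    (hδ₀ : 0 ≤ δ₀) (hKP : 0 ≤ KP) (hBO : 0 ≤ BO) (hΛ : 0 ≤ Λ) (hasep : 0 ≤ asep) (hρ : 0 ≤ ρ) (hsplit : αst + asep + ρ ≤ aP)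
    (h261 : Ineq261 dB (toB6 (geo9K i) Rr Hp) δ₀ (bO - ρ)) (hST : ScaleTransfer (geo9K i) δ₀ αst Λ (fun a => (geo9K i).len a ^ 2))
    (hP : HasMajorant (g := toB6 (geo9K i) Rr Hp) (fun p : FBondY i × ι => ιB (blkV1 i.hN i.D p.1)) (conj b (P.restrictScalars ℝ))
      (fun a y => KP * ((geo9K i).len a ^ 2)⁻¹ * Real.exp (-(aP * δ₀ * (geo9K i).dist a y))))
    (hO : HasMajorant (g := toB6 (geo9K i) Rr Hp) (fun p : FBondY i × ι => ιB (blkV1 i.hN i.D p.1)) (conj b (O.restrictScalars ℝ))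
      (fun y b' => BO * (geo9K i).len y ^ 2 * Real.exp (-(bO * δ₀ * (geo9K i).dist y b')))) :
    HasMajorant (g := toB6 (geo9K i) Rr Hp) (fun p : FBondY i × ι => ιB (blkV1 i.hN i.D p.1))
      (conj b (((1 - cutMulY (𝔸 := 𝔸) (hBdY i ζ)) * P *
        (cutMulY (𝔸 := 𝔸) (hBdY i (hTY i c)) * O * cutMulY (𝔸 := 𝔸) (hBdY i (hTY i c)))).restrictScalars ℝ))
      (fun a b' => (if b' ∈ SQT i c then (1 : ℝ) else 0) *
        ((KP * BO * Λ * B6.c1 dB δ₀ (bO - ρ) * Real.exp (-(asep * δ₀ * Dsep))) * Real.exp (-(ρ * δ₀ * (geo9K i).dist a b')))) := by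
  obtain ⟨htri, hsymm, hdnn⟩ := geo9K_axioms i Rr Hp
  have hℓ2 : ∀ a : (geo9K i).Site, 0 ≤ (geo9K i).len a ^ 2 := fun a => sq_nonneg _
  have hℓ2i : ∀ a : (geo9K i).Site, 0 ≤ ((geo9K i).len a ^ 2)⁻¹ := fun a => inv_nonneg.2 (hℓ2 a)
  set blk : FBondY i × ι → (geo9K i).Site := fun p => ιB (blkV1 i.hN i.D p.1) with hblk
  set Sf : Finset (geo9K i).Site := Finset.univ.filter fun a => ∃ f : FBondY i, ιB (blkV1 i.hN i.D f) = a ∧ hBdY i ζ f ≠ 1 with hSf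
  have hmemSf : ∀ a, a ∈ Sf ↔ ∃ f : FBondY i, ιB (blkV1 i.hN i.D f) = a ∧ hBdY i ζ f ≠ 1 := fun a => by simp [hSf]
  set Z : Finset (geo9K i).Site := Finset.univ.filter fun y => ∃ g : FBondY i, ιB (blkV1 i.hN i.D g) = y ∧ hBdY i (hTY i c) g ≠ 0 with hZ
  have hmemZ : ∀ y, y ∈ Z ↔ ∃ g : FBondY i, ιB (blkV1 i.hN i.D g) = y ∧ hBdY i (hTY i c) g ≠ 0 := fun y => by simp [hZ]
  set f : FBondY i × ι → ℝ := fun p => 1 - hBdY i ζ p.1 with hf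
  set m : FBondY i × ι → ℝ := fun p => hBdY i (hTY i c) p.1 with hm
  have hf1 : ∀ p, |f p| ≤ 1 := fun p => hζ1 _
  have hf0 : ∀ p, blk p ∉ Sf → f p = 0 := fun p hp => by
    by_contra hne
    exact hp ((hmemSf _).2 ⟨p.1, rfl, fun h1 => hne (by simp only [hf, h1, sub_self])⟩)
  have hm1 : ∀ p, |m p| ≤ 1 := fun p => B6Partition118KLevelTorus.abs_hT_le_one i.D (one_le_Mh i) (B9GeoLemma21KLevelV1.one_le_P i) c _
  have hm0 : ∀ p, blk p ∉ Z → m p = 0 := fun p hp => by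
    by_contra hne
    exact hp ((hmemZ _).2 ⟨p.1, rfl, hne⟩)
  have hsep : ∀ a ∈ Sf, ∀ y ∈ Z, Dsep ≤ (geo9K i).dist a y := fun a ha y hy => by
    obtain ⟨f', hf', hne⟩ := (hmemSf a).1 ha
    obtain ⟨g', hg', hne'⟩ := (hmemZ y).1 hy
    rw [← hf', ← hg']
    exact hζsep f' g' hne hne'
  have hA := sepMiddle_majorant_blk (R := Rr) (H := Hp) blk dB δ₀ aP αst asep ρ bO KP BO Λ Dsep
    (fun a => ((geo9K i).len a ^ 2)⁻¹) (fun a => (geo9K i).len a ^ 2) (fun a => (geo9K i).len a ^ 2) Sf Z f m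
    hKP hBO hΛ hℓ2i hℓ2 hℓ2 hδ₀ hasep hρ hsplit htri hsymm hdnn hST h261 hf1 hf0 hm1 hm0 hsep hP hO
  have hA' : HasMajorant (g := toB6 (geo9K i) Rr Hp) blk
      (mulOp f * conj b (P.restrictScalars ℝ) * mulOp m * conj b (O.restrictScalars ℝ))
      (fun a b' => (KP * BO * Λ * B6.c1 dB δ₀ (bO - ρ) * Real.exp (-(asep * δ₀ * Dsep))) * Real.exp (-(ρ * δ₀ * (geo9K i).dist a b'))) := by
    refine hasMajorant_mono (g := toB6 (geo9K i) Rr Hp) _ hA fun a b' => ?_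
    have hw : ((geo9K i).len a ^ 2)⁻¹ * (geo9K i).len a ^ 2 = 1 := inv_mul_cancel₀ (pow_ne_zero 2 (B6KLevelCensusIndexV1.len_pos i a).ne')
    have hκ : 0 ≤ KP * BO * Λ * B6.c1 dB δ₀ (bO - ρ) * Real.exp (-(asep * δ₀ * Dsep)) :=
      mul_nonneg (mul_nonneg (mul_nonneg (mul_nonneg hKP hBO) hΛ) (c1_nonneg _ _ _)) (Real.exp_nonneg _)
    rw [hw, mul_one]
    have hind : (if a ∈ Sf then (1 : ℝ) else 0) ≤ 1 := by split_ifs <;> norm_num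
    calc (if a ∈ Sf then (1 : ℝ) else 0) * (KP * BO * Λ * B6.c1 dB δ₀ (bO - ρ) * Real.exp (-(asep * δ₀ * Dsep))) *
          Real.exp (-(ρ * δ₀ * (geo9K i).dist a b'))
        ≤ 1 * (KP * BO * Λ * B6.c1 dB δ₀ (bO - ρ) * Real.exp (-(asep * δ₀ * Dsep))) * Real.exp (-(ρ * δ₀ * (geo9K i).dist a b')) :=
          mul_le_mul_of_nonneg_right (mul_le_mul_of_nonneg_right hind hκ) (Real.exp_nonneg _)
      _ = _ := by rw [one_mul]
  have hB := hasMajorant_mul_mulOp_right (R := Rr) (H := Hp) blk hA' m hm1 (SQT i c) (fun p hp => mem_SQT_of_hBdY_hTY_ne_zero i c ιB hι hp)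
  rw [conj_famTwo_eq]
  exact hB

end Literature.MathematicalPhysics.QuantumFieldTheory.Balaban1983to89.B9Eq3105FamTwoCore

end
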